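import Mathlib.Tactic

/-!
# Lemma T — finite-model instances (bsd-idea-19 g24; crux `ManinPrimeToAdditiveFiveLe`, two-parity line)

Finite model of Lemma T of `Cruxes/ManinPrimeToAdditiveFiveLe/Lines/two-parity-modular-unit-note.md` §2.
In `𝔽_p[X]/(X^(p-1)) ≅ ℤ[ζ_p]/(p)` (`ζ_p ↦ 1 + X`, `ω^{-a}(y) ↦ y^(p-1-a)`), for `1 ≤ a ≤ p-2`, `c ≠ 0`:

* (T1) `Σ_{x mod p} (x-u)^(p-1-a) (1+X)^(c x)` has `X`-order exactly `a`;
* (T2) for `u ≠ v`, `Σ_{x mod p} ((x-u)(x-v))^(p-1-a) (1+X)^(c x)` has `X`-order exactly `max 0 (2a-(p-1))`.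

(`X`-order `k ≤ p-2` in the truncated ring means `𝔓`-valuation exactly `k/(p-1)` in `ℤ[ζ_p]`.)
Truncated polynomials are coefficient lists of length `p-1` over `ℕ`, reduced mod `p`.  The checks are
Boolean and closed by `decide` (`p = 5`) and `native_decide` (`p = 7, 11, 13`; compiled evaluation — this file is a
workfile, not a `Theorems/` file, and nothing imports it).  BSD / C5 / R / I9 are not touched by anything here.
-/

set_option linter.dupNamespace false

namespace Summit.BirchSwinnertonDyer.BirchSwinnertonDyer.Cruxes.ManinPrimeToAdditiveFiveLe.TwoParity

/-- coefficientwise sum mod `p` of two truncated polynomials (same length) -/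
def addL (p : ℕ) (f g : List ℕ) : List ℕ := List.zipWith (fun s t => (s + t) % p) f g

/-- scalar multiple mod `p` -/
def smulL (p s : ℕ) (f : List ℕ) : List ℕ := f.map (fun t => s * t % p)

/-- product in `𝔽_p[X]/(X^n)` of two coefficient lists -/
def mulL (p n : ℕ) (f g : List ℕ) : List ℕ :=
  (List.range n).map (fun i => ((List.range (i + 1)).map (fun j => f.getD j 0 * g.getD (i - j) 0)).sum % p)

/-- the constant `1` and the zero of `𝔽_p[X]/(X^n)` -/
def oneL (n : ℕ) : List ℕ := (List.range n).map (fun i => if i = 0 then 1 else 0)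
def zeroL (n : ℕ) : List ℕ := (List.range n).map (fun _ => 0)

/-- `(1+X)^e` in `𝔽_p[X]/(X^n)` -/
def zetaPow (p n : ℕ) : ℕ → List ℕ
  | 0 => oneL n
  | e + 1 => mulL p n (zetaPow p n e) ((List.range n).map (fun i => if i ≤ 1 then 1 else 0))

/-- (T1) sum: `Σ_x (x-u)^(p-1-a) ζ^(c x)`, as a list of `p-1` coefficients mod `p` -/
def T1L (p a u c : ℕ) : List ℕ :=
  ((List.range p).map (fun x => smulL p (((x + p - u) ^ (p - 1 - a)) % p) (zetaPow p (p - 1) (c * x % p)))).foldr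
    (addL p) (zeroL (p - 1))

/-- (T2) sum: `Σ_x ((x-u)(x-v))^(p-1-a) ζ^(c x)` -/
def T2L (p a u v c : ℕ) : List ℕ :=
  ((List.range p).map (fun x =>
      smulL p ((((x + p - u) * (x + p - v)) ^ (p - 1 - a)) % p) (zetaPow p (p - 1) (c * x % p)))).foldr
    (addL p) (zeroL (p - 1))

/-- "`f` has `X`-order exactly `k`": coefficients below `k` vanish mod `p`, the `k`-th does not -/
def ordIs (p : ℕ) (f : List ℕ) (k : ℕ) : Bool :=
  ((List.range k).all (fun i => f.getD i 0 % p == 0)) && (f.getD k 0 % p != 0)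

/-- all instances of (T1) at the prime `p`: `1 ≤ a ≤ p-2`, `u` arbitrary, `c ≠ 0` -/
def checkT1 (p : ℕ) : Bool :=
  (List.range (p - 1)).all (fun a => (a == 0) ||
    (List.range p).all (fun u => (List.range p).all (fun c => (c == 0) || ordIs p (T1L p a u c) a)))

/-- all instances of (T2) at the prime `p`: `1 ≤ a ≤ p-2`, `u ≠ v`, `c ≠ 0`; predicted order `2a-(p-1)` truncated at `0` -/
def checkT2 (p : ℕ) : Bool :=
  (List.range (p - 1)).all (fun a => (a == 0) ||
    (List.range p).all (fun u => (List.range p).all (fun v => (u == v) ||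
      (List.range p).all (fun c => (c == 0) || ordIs p (T2L p a u v c) (2 * a - (p - 1))))))

/-- sanity: the model is not vacuous — at `p = 5`, `a = 1`, the (T1) sum is not of order `0` and not of order `2`. -/
theorem T1_model_5_sharp : ordIs 5 (T1L 5 1 0 1) 0 = false ∧ ordIs 5 (T1L 5 1 0 1) 2 = false := by decide

theorem lemmaT1_model_5 : checkT1 5 = true := by decide
theorem lemmaT2_model_5 : checkT2 5 = true := by decide
theorem lemmaT1_model_7 : checkT1 7 = true := by native_decide
theorem lemmaT2_model_7 : checkT2 7 = true := by native_decide
theorem lemmaT1_model_11 : checkT1 11 = true := by native_decide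
theorem lemmaT2_model_11 : checkT2 11 = true := by native_decide
theorem lemmaT1_model_13 : checkT1 13 = true := by native_decide
theorem lemmaT2_model_13 : checkT2 13 = true := by native_decide

end Summit.BirchSwinnertonDyer.BirchSwinnertonDyer.Cruxes.ManinPrimeToAdditiveFiveLe.TwoParity
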